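import Mathlib.Analysis.Normed.Field.Krasner
import Mathlib.Analysis.Normed.Group.Ultra
import Mathlib.FieldTheory.Separable

/-!
# Krasner continuity of roots: nearby monic polynomials generate the same extensions

Classical local-field analysis (Mathlib-only; no disputed input; written for the abc-iut cell as piece
**K1** of the discharge of the campaign-S named fact `krasner_finite_subextensions` — "a local field has
only finitely many extensions of bounded degree inside a fixed algebraic closure", Lang, *Algebraic Number
Theory*, II §5 Prop. 14; Bombieri–Gubler, *Heights*, Prop. 4.5.3 — whose proof is: (K1) Krasner continuity
of roots + (K2) a compact family of separable integral polynomials generating every extension of the given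
degree + (K3) compactness).

**What is proved (K1).** Let `L` be a normed field with an ultrametric norm, `K ⊆ L` a subfield for which
Krasner's lemma holds (`IsKrasner K L`; by Mathlib's `IsKrasner.of_completeSpace` this is the case for
every algebraic normed extension of a complete nontrivially normed ultrametric field, e.g. `K = ℚ_[p]` and
`L` its algebraic closure with the spectral norm). Let `f, g ∈ K[X]` be MONIC of the same degree `n ≥ 1`,
split in `L`, with all coefficients of norm `≤ 1`, `f` separable, and suppose the coefficients of `g` are
within `ρⁿ` of those of `f`, where `ρ` is smaller than the distance between any two distinct roots of `f`.
Then (`KrasnerContinuity.main`):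
* every root `β` of `g` lies within `ρ` of exactly one root `α` of `f`, and every root of `f` is so
  approximated (`exists_root_near`, `exists_root_near'`, `root_near_unique`);
* `g` is separable (`separable_of_near`) and its distinct roots are more than `ρ` apart;
* for each root `β` of `g` and its companion root `α` of `f`, **`K⟮β⟯ = K⟮α⟯`** (two applications of
  Krasner's lemma, `IsKrasner.krasner`).
Ingredients (all here, elementary): over an ultrametric normed field a polynomial with coefficients of norm
`≤ C` has `‖p(x)‖ ≤ C` for `‖x‖ ≤ 1` (`norm_eval_le_of_coeff_le`); roots of a monic polynomial with
integral coefficients are integral, `‖β‖ ≤ 1` (`norm_le_one_of_isRoot`); for a split monic `p` of degree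
`n ≥ 1` and any `x` some root `α` has `‖x − α‖ⁿ ≤ ‖p(x)‖` (`exists_root_norm_sub_pow_le`).
[cite: LangANT1994, II §5 Prop 14] [folklore]
-/

namespace Literature.NumberTheory.NumberFields.KrasnerContinuity

open Polynomial IntermediateField

section Ultrametric

variable {L : Type*} [NormedField L]

section
variable [IsUltrametricDist L]

/-- Over an ultrametric normed field, a polynomial all of whose coefficients have norm `≤ C` (`C ≥ 0`)
takes values of norm `≤ C` on the closed unit ball. [cite: LangANT1994, II §5 Prop 14] -/
theorem norm_eval_le_of_coeff_le (p : L[X]) {C : ℝ} (hC : 0 ≤ C) (hp : ∀ i, ‖p.coeff i‖ ≤ C)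
    {x : L} (hx : ‖x‖ ≤ 1) : ‖p.eval x‖ ≤ C := by
  rw [eval_eq_sum_range]
  refine IsUltrametricDist.norm_sum_le_of_forall_le_of_nonneg hC fun i _ => ?_
  rw [norm_mul, norm_pow]
  calc ‖p.coeff i‖ * ‖x‖ ^ i ≤ C * 1 :=
        mul_le_mul (hp i) (pow_le_one₀ (norm_nonneg _) hx) (by positivity) hC
    _ = C := mul_one C

/-- Over an ultrametric normed field, every root of a MONIC polynomial with coefficients of norm `≤ 1`
has norm `≤ 1` (roots of integral polynomials are integral). [cite: LangANT1994, II §5 Prop 14] -/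
theorem norm_le_one_of_isRoot {p : L[X]} (hm : p.Monic) (hp : ∀ i, ‖p.coeff i‖ ≤ 1) {x : L}
    (hx : p.IsRoot x) : ‖x‖ ≤ 1 := by
  by_contra h
  push Not at h
  have h1 : (1 : ℝ) ≤ ‖x‖ := h.le
  set n := p.natDegree with hn
  -- `p = 1` has no roots, so `n ≥ 1`
  have hn0 : n ≠ 0 := by
    intro h0
    have hp1 : p = 1 := hm.natDegree_eq_zero.mp h0
    rw [hp1, IsRoot.def, eval_one] at hx
    exact one_ne_zero hx
  -- `x ^ n = -(∑_{i<n} pᵢ xⁱ)`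
  have hsum : p.eval x = (∑ i ∈ Finset.range n, p.coeff i * x ^ i) + x ^ n := by
    rw [eval_eq_sum_range, Finset.sum_range_succ, ← hn, hm.coeff_natDegree, one_mul]
  have hxn : x ^ n = -(∑ i ∈ Finset.range n, p.coeff i * x ^ i) := by
    rw [IsRoot.def, hsum] at hx
    exact eq_neg_of_add_eq_zero_right hx
  -- every term of the sum has norm `≤ ‖x‖ ^ (n - 1)`
  have hbound : ‖∑ i ∈ Finset.range n, p.coeff i * x ^ i‖ ≤ ‖x‖ ^ (n - 1) := by
    refine IsUltrametricDist.norm_sum_le_of_forall_le_of_nonneg (by positivity) fun i hi => ?_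
    rw [Finset.mem_range] at hi
    rw [norm_mul, norm_pow]
    calc ‖p.coeff i‖ * ‖x‖ ^ i ≤ 1 * ‖x‖ ^ (n - 1) := by
          refine mul_le_mul (hp i) (pow_le_pow_right₀ h1 (by omega)) (by positivity) zero_le_one
      _ = ‖x‖ ^ (n - 1) := one_mul _
  have hlt : ‖x‖ ^ (n - 1) < ‖x‖ ^ n := by
    exact pow_lt_pow_right₀ h (by omega)
  have : ‖x ^ n‖ ≤ ‖x‖ ^ (n - 1) := by rw [hxn, norm_neg]; exact hbound
  rw [norm_pow] at this
  exact absurd (lt_of_le_of_lt this hlt) (lt_irrefl _)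

end

/-- For a split monic polynomial `p` of degree `n ≥ 1` over an ultrametric (indeed any) normed field and
any `x`, some root `α` of `p` satisfies `‖x − α‖ ^ n ≤ ‖p(x)‖` (since `p(x) = ∏ (x − α)`). [cite: LangANT1994, II §5 Prop 14] -/
theorem exists_root_norm_sub_pow_le {p : L[X]} (hm : p.Monic) (hs : p.Splits) (hn : 0 < p.natDegree)
    (x : L) : ∃ α ∈ p.roots, ‖x - α‖ ^ p.natDegree ≤ ‖p.eval x‖ := by
  classical
  have hcard : Multiset.card p.roots = p.natDegree := hs.natDegree_eq_card_roots.symm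
  have hne : p.roots ≠ 0 := by
    intro h0; rw [h0, Multiset.card_zero] at hcard; omega
  obtain ⟨α₀, hα₀⟩ := Multiset.exists_mem_of_ne_zero hne
  -- a root minimising the distance to `x`
  obtain ⟨α, hα, hmin⟩ := Finset.exists_min_image p.roots.toFinset (fun α => ‖x - α‖)
    ⟨α₀, Multiset.mem_toFinset.mpr hα₀⟩
  refine ⟨α, Multiset.mem_toFinset.mp hα, ?_⟩
  rw [hs.eval_eq_prod_roots_of_monic hm, ← hcard]
  have hnorm : ‖(p.roots.map (x - ·)).prod‖ = ((p.roots.map (x - ·)).map (‖·‖)).prod := by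
    rw [show (‖·‖ : L → ℝ) = normHom from rfl, ← map_multiset_prod]; rfl
  rw [hnorm, Multiset.map_map]
  -- `a ^ card s ≤ s.prod` whenever `0 ≤ a ≤` every member of `s` (also landed, for `ℂ`-roots, as
  -- `RoyWaldschmidt1997.pow_card_le_multiset_prod`; restated locally to keep this file's imports light)
  have key : ∀ (s : Multiset ℝ) {a : ℝ}, 0 ≤ a → (∀ r ∈ s, a ≤ r) → a ^ Multiset.card s ≤ s.prod := by
    intro s a ha h
    induction s using Multiset.induction_on with
    | empty => simp
    | cons b s ih =>
      rw [Multiset.card_cons, Multiset.prod_cons, pow_succ, mul_comm]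
      have hb : a ≤ b := h b (Multiset.mem_cons_self b s)
      exact mul_le_mul hb (ih fun r hr => h r (Multiset.mem_cons_of_mem hr)) (pow_nonneg ha _)
        (ha.trans hb)
  have := key (p.roots.map (fun α' => ‖x - α'‖)) (norm_nonneg (x - α))
    (by
      intro r hr
      obtain ⟨α', hα', rfl⟩ := Multiset.mem_map.mp hr
      exact hmin α' (Multiset.mem_toFinset.mpr hα'))
  rwa [Multiset.card_map] at this

/-- Ultrametric three-point estimate. [cite: LangANT1994, II §5 Prop 14] -/
theorem norm_sub_le_max_three [IsUltrametricDist L] (a b c d : L) :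
    ‖a - d‖ ≤ max ‖a - b‖ (max ‖b - c‖ ‖c - d‖) := by
  have h1 : ‖a - d‖ ≤ max ‖a - b‖ ‖b - d‖ := by
    simpa [sub_add_sub_cancel] using IsUltrametricDist.norm_add_le_max (a - b) (b - d)
  have h2 : ‖b - d‖ ≤ max ‖b - c‖ ‖c - d‖ := by
    simpa [sub_add_sub_cancel] using IsUltrametricDist.norm_add_le_max (b - c) (c - d)
  exact h1.trans (max_le_max le_rfl h2)

end Ultrametric

section Main

variable {K L : Type*} [Field K] [NormedField L] [Algebra K L]

/-- Membership in the root set of a polynomial over `K`, read on the mapped polynomial over `L`. [cite: LangANT1994, II §5 Prop 14] -/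
theorem mem_rootSet_iff_isRoot_map {f : K[X]} (hf : f ≠ 0) (x : L) :
    x ∈ f.rootSet L ↔ (f.map (algebraMap K L)).IsRoot x := by
  rw [mem_rootSet, IsRoot.def, eval_map, ← aeval_def]
  exact ⟨fun h => h.2, fun h => ⟨hf, h⟩⟩

/-- The root set of `g` has at most `deg g` elements. [cite: LangANT1994, II §5 Prop 14] -/
theorem card_rootSet_le_natDegree (g : K[X]) : Fintype.card (g.rootSet L) ≤ g.natDegree := by
  classical
  rw [← natDegree_map (algebraMap K L)]
  simp_rw [rootSet_def, Finset.coe_sort_coe, Fintype.card_coe]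
  exact (Multiset.toFinset_card_le _).trans (card_roots' _)

/-- The data of the continuity theorem: two monic polynomials of the same degree `n ≥ 1` over `K`, split in
`L`, with integral coefficients, `f` separable, the coefficients `ρⁿ`-close, and `ρ` below the root
separation of `f`. [cite: LangANT1994, II §5 Prop 14] -/
structure NearPair (K L : Type*) [Field K] [NormedField L] [Algebra K L] where
  /-- the reference polynomial [cite: LangANT1994, II §5 Prop 14] -/
  f : K[X]
  /-- the perturbed polynomial [cite: LangANT1994, II §5 Prop 14] -/
  g : K[X]
  /-- the proximity radius [cite: LangANT1994, II §5 Prop 14] -/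
  ρ : ℝ
  f_monic : f.Monic
  g_monic : g.Monic
  natDegree_eq : g.natDegree = f.natDegree
  natDegree_pos : 0 < f.natDegree
  f_separable : f.Separable
  f_splits : (f.map (algebraMap K L)).Splits
  g_splits : (g.map (algebraMap K L)).Splits
  f_coeff_le : ∀ i, ‖(f.map (algebraMap K L)).coeff i‖ ≤ 1
  g_coeff_le : ∀ i, ‖(g.map (algebraMap K L)).coeff i‖ ≤ 1
  ρ_nonneg : 0 ≤ ρ
  close : ∀ i, ‖(f.map (algebraMap K L)).coeff i - (g.map (algebraMap K L)).coeff i‖ ≤ ρ ^ f.natDegree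
  separated : ∀ α ∈ f.rootSet L, ∀ α' ∈ f.rootSet L, α ≠ α' → ρ < ‖α - α'‖

namespace NearPair

variable (P : NearPair K L)

/-- `f ≠ 0`. [cite: LangANT1994, II §5 Prop 14] -/
theorem f_ne_zero : P.f ≠ 0 := P.f_monic.ne_zero

/-- `g ≠ 0`. [cite: LangANT1994, II §5 Prop 14] -/
theorem g_ne_zero : P.g ≠ 0 := P.g_monic.ne_zero

variable [IsUltrametricDist L]

/-- Roots of `g` are integral: `‖β‖ ≤ 1`. [cite: LangANT1994, II §5 Prop 14] -/
theorem norm_le_one_of_mem_rootSet_g {β : L} (hβ : β ∈ P.g.rootSet L) : ‖β‖ ≤ 1 :=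
  norm_le_one_of_isRoot (P.g_monic.map _) P.g_coeff_le ((mem_rootSet_iff_isRoot_map P.g_ne_zero β).mp hβ)

/-- Roots of `f` are integral: `‖α‖ ≤ 1`. [cite: LangANT1994, II §5 Prop 14] -/
theorem norm_le_one_of_mem_rootSet_f {α : L} (hα : α ∈ P.f.rootSet L) : ‖α‖ ≤ 1 :=
  norm_le_one_of_isRoot (P.f_monic.map _) P.f_coeff_le ((mem_rootSet_iff_isRoot_map P.f_ne_zero α).mp hα)

/-- At a root `β` of `g`, `‖f(β)‖ ≤ ρⁿ`. [cite: LangANT1994, II §5 Prop 14] -/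
theorem norm_eval_f_le {β : L} (hβ : β ∈ P.g.rootSet L) :
    ‖(P.f.map (algebraMap K L)).eval β‖ ≤ P.ρ ^ P.f.natDegree := by
  have hg : (P.g.map (algebraMap K L)).eval β = 0 :=
    (mem_rootSet_iff_isRoot_map P.g_ne_zero β).mp hβ
  have : (P.f.map (algebraMap K L)).eval β =
      (P.f.map (algebraMap K L) - P.g.map (algebraMap K L)).eval β := by
    rw [eval_sub, hg, sub_zero]
  rw [this]
  exact norm_eval_le_of_coeff_le _ (pow_nonneg P.ρ_nonneg _) (fun i => by rw [coeff_sub]; exact P.close i)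
    (P.norm_le_one_of_mem_rootSet_g hβ)

/-- At a root `α` of `f`, `‖g(α)‖ ≤ ρⁿ`. [cite: LangANT1994, II §5 Prop 14] -/
theorem norm_eval_g_le {α : L} (hα : α ∈ P.f.rootSet L) :
    ‖(P.g.map (algebraMap K L)).eval α‖ ≤ P.ρ ^ P.f.natDegree := by
  have hf : (P.f.map (algebraMap K L)).eval α = 0 :=
    (mem_rootSet_iff_isRoot_map P.f_ne_zero α).mp hα
  have : (P.g.map (algebraMap K L)).eval α =
      -((P.f.map (algebraMap K L) - P.g.map (algebraMap K L)).eval α) := by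
    rw [eval_sub, hf, zero_sub, neg_neg]
  rw [this, norm_neg]
  exact norm_eval_le_of_coeff_le _ (pow_nonneg P.ρ_nonneg _) (fun i => by rw [coeff_sub]; exact P.close i)
    (P.norm_le_one_of_mem_rootSet_f hα)

/-- **Root proximity.** Every root `β` of `g` lies within `ρ` of some root `α` of `f`. [cite: LangANT1994, II §5 Prop 14] -/
theorem exists_root_near {β : L} (hβ : β ∈ P.g.rootSet L) :
    ∃ α ∈ P.f.rootSet L, ‖β - α‖ ≤ P.ρ := by
  obtain ⟨α, hα, hle⟩ := exists_root_norm_sub_pow_le (P.f_monic.map (algebraMap K L)) P.f_splits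
    (by rw [natDegree_map]; exact P.natDegree_pos) β
  refine ⟨α, ?_, ?_⟩
  · exact (mem_rootSet_iff_isRoot_map P.f_ne_zero α).mpr ((mem_roots (P.f_monic.map _).ne_zero).mp hα)
  · rw [natDegree_map] at hle
    have h := hle.trans (P.norm_eval_f_le hβ)
    exact (pow_le_pow_iff_left₀ (norm_nonneg _) P.ρ_nonneg P.natDegree_pos.ne').mp h

/-- **Root proximity, conversely.** Every root `α` of `f` lies within `ρ` of some root `β` of `g`. [cite: LangANT1994, II §5 Prop 14] -/
theorem exists_root_near' {α : L} (hα : α ∈ P.f.rootSet L) :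
    ∃ β ∈ P.g.rootSet L, ‖α - β‖ ≤ P.ρ := by
  obtain ⟨β, hβ, hle⟩ := exists_root_norm_sub_pow_le (P.g_monic.map (algebraMap K L)) P.g_splits
    (by rw [natDegree_map, P.natDegree_eq]; exact P.natDegree_pos) α
  refine ⟨β, ?_, ?_⟩
  · exact (mem_rootSet_iff_isRoot_map P.g_ne_zero β).mpr ((mem_roots (P.g_monic.map _).ne_zero).mp hβ)
  · rw [natDegree_map, P.natDegree_eq] at hle
    have h := hle.trans (P.norm_eval_g_le hα)
    exact (pow_le_pow_iff_left₀ (norm_nonneg _) P.ρ_nonneg P.natDegree_pos.ne').mp h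

/-- **Uniqueness.** Two roots of `f` within `ρ` of the same point coincide. [cite: LangANT1994, II §5 Prop 14] -/
theorem root_near_unique {β α α' : L} (hα : α ∈ P.f.rootSet L) (hα' : α' ∈ P.f.rootSet L)
    (h : ‖β - α‖ ≤ P.ρ) (h' : ‖β - α'‖ ≤ P.ρ) : α = α' := by
  by_contra hne
  have hlt := P.separated α hα α' hα' hne
  have hle : ‖α - α'‖ ≤ max ‖α - β‖ ‖β - α'‖ := by
    simpa [sub_add_sub_cancel] using IsUltrametricDist.norm_add_le_max (α - β) (β - α')
  rw [norm_sub_rev α β] at hle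
  exact absurd (hlt.trans_le (hle.trans (max_le h h'))) (lt_irrefl _)

/-- The companion root: the (unique) root of `f` within `ρ` of a given root of `g`. [cite: LangANT1994, II §5 Prop 14] -/
noncomputable def companion (β : P.g.rootSet L) : P.f.rootSet L :=
  ⟨(P.exists_root_near β.2).choose, (P.exists_root_near β.2).choose_spec.1⟩

/-- The companion root is within `ρ`. [cite: LangANT1994, II §5 Prop 14] -/
theorem norm_sub_companion_le (β : P.g.rootSet L) : ‖(β : L) - P.companion β‖ ≤ P.ρ :=
  (P.exists_root_near β.2).choose_spec.2

/-- Any root of `f` within `ρ` of `β` is the companion. [cite: LangANT1994, II §5 Prop 14] -/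
theorem companion_eq_of_near (β : P.g.rootSet L) {α : L} (hα : α ∈ P.f.rootSet L)
    (h : ‖(β : L) - α‖ ≤ P.ρ) : (P.companion β : L) = α :=
  P.root_near_unique (P.companion β).2 hα (P.norm_sub_companion_le β) h

/-- The companion map `roots(g) → roots(f)` is surjective. [cite: LangANT1994, II §5 Prop 14] -/
theorem companion_surjective : Function.Surjective P.companion := by
  intro α
  obtain ⟨β, hβ, hle⟩ := P.exists_root_near' α.2
  refine ⟨⟨β, hβ⟩, Subtype.ext ?_⟩
  exact P.companion_eq_of_near ⟨β, hβ⟩ α.2 (by rw [norm_sub_rev]; exact hle)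

/-- `g` has exactly `n` distinct roots in `L`. [cite: LangANT1994, II §5 Prop 14] -/
theorem card_rootSet_g : Fintype.card (P.g.rootSet L) = P.g.natDegree := by
  refine le_antisymm (card_rootSet_le_natDegree P.g) ?_
  rw [P.natDegree_eq, ← card_rootSet_eq_natDegree P.f_separable P.f_splits]
  exact Fintype.card_le_of_surjective _ P.companion_surjective

/-- **The perturbed polynomial is separable.** [cite: LangANT1994, II §5 Prop 14] -/
theorem separable_of_near : P.g.Separable :=
  (card_rootSet_eq_natDegree_iff_of_splits P.g_ne_zero P.g_splits).mp P.card_rootSet_g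

/-- The companion map is a bijection `roots(g) ≃ roots(f)`. [cite: LangANT1994, II §5 Prop 14] -/
theorem companion_bijective : Function.Bijective P.companion := by
  rw [Fintype.bijective_iff_surjective_and_card]
  refine ⟨P.companion_surjective, ?_⟩
  rw [P.card_rootSet_g, P.natDegree_eq, card_rootSet_eq_natDegree P.f_separable P.f_splits]

/-- Distinct roots of `g` are more than `ρ` apart. [cite: LangANT1994, II §5 Prop 14] -/
theorem separated_g {β β' : L} (hβ : β ∈ P.g.rootSet L) (hβ' : β' ∈ P.g.rootSet L) (hne : β ≠ β') :
    P.ρ < ‖β - β'‖ := by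
  by_contra hle
  push Not at hle
  have hinj := P.companion_bijective.1
  have hc : P.companion ⟨β, hβ⟩ ≠ P.companion ⟨β', hβ'⟩ := by
    intro h; exact hne (congrArg Subtype.val (hinj h))
  have hsep := P.separated _ (P.companion ⟨β, hβ⟩).2 _ (P.companion ⟨β', hβ'⟩).2
    (fun h => hc (Subtype.ext h))
  have h3 := norm_sub_le_max_three (P.companion ⟨β, hβ⟩ : L) β β' (P.companion ⟨β', hβ'⟩ : L)
  have h1 : ‖(P.companion ⟨β, hβ⟩ : L) - β‖ ≤ P.ρ := by
    rw [norm_sub_rev]; exact P.norm_sub_companion_le ⟨β, hβ⟩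
  have h2 : ‖β' - (P.companion ⟨β', hβ'⟩ : L)‖ ≤ P.ρ := P.norm_sub_companion_le ⟨β', hβ'⟩
  exact absurd (hsep.trans_le (h3.trans (max_le h1 (max_le hle h2)))) (lt_irrefl _)

omit [IsUltrametricDist L] in
/-- A conjugate over `K` of a root of `f` is a root of `f`. [cite: LangANT1994, II §5 Prop 14] -/
theorem mem_rootSet_of_isConjRoot {p : K[X]} (hp : p ≠ 0) {x x' : L} (hx : x ∈ p.rootSet L)
    (h : IsConjRoot K x x') : x' ∈ p.rootSet L := by
  rw [mem_rootSet] at hx ⊢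
  refine ⟨hp, ?_⟩
  obtain ⟨q, hq⟩ := minpoly.dvd K x hx.2
  rw [hq, map_mul, show aeval x' (minpoly K x) = 0 by rw [h, minpoly.aeval], zero_mul]

variable [IsKrasner K L]

/-- **Krasner, first application:** the companion root `α` of `f` lies in `K⟮β⟯`. [cite: LangANT1994, II §5 Prop 14] -/
theorem companion_mem_adjoin (β : P.g.rootSet L) : (P.companion β : L) ∈ K⟮(β : L)⟯ := by
  have hα := (P.companion β).2
  have hαf : aeval (P.companion β : L) P.f = 0 := (mem_rootSet.mp hα).2
  have hβg : aeval (β : L) P.g = 0 := (mem_rootSet.mp β.2).2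
  refine IsKrasner.krasner (K := K) ?_ ?_ ?_ ?_
  · exact P.f_separable.of_dvd (minpoly.dvd K _ hαf)
  · exact Polynomial.Splits.of_dvd P.f_splits (Polynomial.map_ne_zero P.f_ne_zero)
      (Polynomial.map_dvd _ (minpoly.dvd K _ hαf))
  · exact ⟨P.g, P.g_monic, by rw [← aeval_def]; exact hβg⟩
  · intro x' hx' hne
    have hx'f : x' ∈ P.f.rootSet L := mem_rootSet_of_isConjRoot P.f_ne_zero hα hx'
    calc ‖(P.companion β : L) - β‖ ≤ P.ρ := by rw [norm_sub_rev]; exact P.norm_sub_companion_le β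
      _ < ‖(P.companion β : L) - x'‖ := P.separated _ hα _ hx'f hne

/-- **Krasner, second application:** the root `β` of `g` lies in `K⟮α⟯` for its companion `α`. [cite: LangANT1994, II §5 Prop 14] -/
theorem mem_adjoin_companion (β : P.g.rootSet L) : (β : L) ∈ K⟮(P.companion β : L)⟯ := by
  have hα := (P.companion β).2
  have hαf : aeval (P.companion β : L) P.f = 0 := (mem_rootSet.mp hα).2
  have hβg : aeval (β : L) P.g = 0 := (mem_rootSet.mp β.2).2
  refine IsKrasner.krasner (K := K) ?_ ?_ ?_ ?_
  · exact P.separable_of_near.of_dvd (minpoly.dvd K _ hβg)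
  · exact Polynomial.Splits.of_dvd P.g_splits (Polynomial.map_ne_zero P.g_ne_zero)
      (Polynomial.map_dvd _ (minpoly.dvd K _ hβg))
  · exact ⟨P.f, P.f_monic, by rw [← aeval_def]; exact hαf⟩
  · intro x' hx' hne
    have hx'g : x' ∈ P.g.rootSet L := mem_rootSet_of_isConjRoot P.g_ne_zero β.2 hx'
    calc ‖(β : L) - P.companion β‖ ≤ P.ρ := P.norm_sub_companion_le β
      _ < ‖(β : L) - x'‖ := P.separated_g β.2 hx'g hne

/-- **Krasner continuity of roots (K1).** For each root `β` of the perturbed polynomial `g` and its companion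
root `α` of `f`: `K⟮β⟯ = K⟮α⟯`. [cite: LangANT1994, II §5 Prop 14] -/
theorem adjoin_eq_adjoin_companion (β : P.g.rootSet L) : K⟮(β : L)⟯ = K⟮(P.companion β : L)⟯ :=
  le_antisymm (adjoin_simple_le_iff.mpr (P.mem_adjoin_companion β))
    (adjoin_simple_le_iff.mpr (P.companion_mem_adjoin β))

/-- **K1, packaged:** every root of `g` generates over `K` the same intermediate field of `L` as some root
of `f` at distance `≤ ρ`; in particular the fields generated by roots of `g` are among the (at most `n`)
fields generated by roots of `f`. [cite: LangANT1994, II §5 Prop 14] -/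
theorem main : ∀ β ∈ P.g.rootSet L, ∃ α ∈ P.f.rootSet L, ‖β - α‖ ≤ P.ρ ∧ K⟮β⟯ = K⟮α⟯ :=
  fun β hβ => ⟨P.companion ⟨β, hβ⟩, (P.companion ⟨β, hβ⟩).2, P.norm_sub_companion_le ⟨β, hβ⟩,
    P.adjoin_eq_adjoin_companion ⟨β, hβ⟩⟩

/-- The set of subfields generated by roots of `g` is contained in the set generated by roots of `f`. [cite: LangANT1994, II §5 Prop 14] -/
theorem adjoin_rootSet_g_subset :
    (fun β : L => K⟮β⟯) '' P.g.rootSet L ⊆ (fun α : L => K⟮α⟯) '' P.f.rootSet L := by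
  rintro _ ⟨β, hβ, rfl⟩
  obtain ⟨α, hα, -, h⟩ := P.main β hβ
  exact ⟨α, hα, h.symm⟩

end NearPair

end Main

end Literature.NumberTheory.NumberFields.KrasnerContinuity
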